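import Mathlib
import Summits.NavierStokesRegularity.NavierStokesRegularity.Theses.SubOnsagerCeiling
import HarnessLib

/-!
# The three tail-ceiling leaves of route SubOnsagerCeiling are NESTED by name:
# `OrthantTailCeiling → ForwardTailCeiling → ForwardTailCeilingKP`
(helper file; hand leafhand-ns-subonsagerceiling-4 gen 4; serves the items stmt-NavierStokesRegularity-25507 (aside),
stmt-26608 (aside) and stmt-27057 (crux) — `--supports` 26608)

The route file types three ν-uniform sub-Onsager tail ceilings over Tao-type cascade tables of `E₂(R)` with the orthant
sign predicate, each a restatement of the previous one (route thesis, rev 1–3):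

* `OrthantTailCeiling` (stmt-25507): ALL orthant tables, tail sums over ALL four modes;
* `ForwardTailCeiling` (stmt-26608): ALL orthant tables, tail sums over a forward-source set `S ⊇ S⁺(α)` chosen after `α`;
* `ForwardTailCeilingKP` (stmt-27057): the same observable on KP networks PROPER only (extra DIAGONAL-FEED hypothesis
  `∀ a b i, a ≠ b → α a b i (0,0,1) = 0`).

This file records the two (trivial) monotonicity implications as kernel facts, so that the ledger's three open items of
this route are by name ONE chain: `forwardTailCeiling_of_orthantTailCeiling` (take `S = univ`),
`forwardTailCeilingKP_of_forwardTailCeiling` (discard the diagonal hypothesis), the composite, and the contrapositives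
(`¬ForwardTailCeilingKP → ¬ForwardTailCeiling → ¬OrthantTailCeiling`): a proof of the strongest leaf would close all three,
a refutation of the weakest would refute all three; the refutations of record run on the two asides only (dead-end pocket
witness `α_SB` for 25507, twin embedding for 26608 — both OUTSIDE the reach of these implications toward 27057).
Together with `Theorems/SubOnsagerCeilingKPCruxCurrency.lean` (stubs of 27057 ⟺ 27057) and
`Theorems/SubOnsagerCeilingOrthantStubCurrency.lean` (stubs of 25507 ⟺ 25507) the by-name map of the leaf is complete.

HONEST FRAMING: bookkeeping about Tao-type MODEL lattice ODEs (route SubOnsagerCeiling, rung TL-M2Break); implications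
between OPEN statements; no stub, crux or summit is proved and nothing here bears on Navier–Stokes regularity.
[cite: Tao2016AveragedNS, §4 (4.13)]
-/

noncomputable section

-- the sub-problem namespace `NavierStokesRegularity.NavierStokesRegularity` is the tree's layout (D-0017)
set_option linter.dupNamespace false

namespace Summit.NavierStokesRegularity.NavierStokesRegularity.Theorems

open Summit.NavierStokesRegularity.NavierStokesRegularity.Theses.SubOnsagerCeiling

/-- **`OrthantTailCeiling → ForwardTailCeiling`**: the all-modes tail ceiling is the forward-source tail ceiling with
the admissible choice `S = univ` (which trivially contains every forward source). [cite: Tao2016AveragedNS, §4 (4.13)] -/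
theorem forwardTailCeiling_of_orthantTailCeiling (h : OrthantTailCeiling) : ForwardTailCeiling := by
  intro R hR ε₀ h0 h1 α hT hO
  obtain ⟨θ, hθ, C, hC, H⟩ := h R hR ε₀ h0 h1 α hT hO
  refine ⟨Finset.univ, fun i hi => absurd (Finset.mem_univ i) hi, θ, hθ, C, hC, ?_⟩
  intro ν hν X₀ s hs X hX0 hXneg hM hXc hXd hXpos n N hnN t ht
  simpa using H ν hν X₀ s hs X hX0 hXneg hM hXc hXd hXpos n N hnN t ht

/-- **`ForwardTailCeiling → ForwardTailCeilingKP`**: the KP crux is the forward-source ceiling restricted to tables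
with diagonal feed forms (the extra hypothesis is simply discarded). [cite: Tao2016AveragedNS, §4 (4.13)] -/
theorem forwardTailCeilingKP_of_forwardTailCeiling (h : ForwardTailCeiling) : ForwardTailCeilingKP := by
  intro R hR ε₀ h0 h1 α hT hO _hD
  exact h R hR ε₀ h0 h1 α hT hO

/-- **`OrthantTailCeiling → ForwardTailCeilingKP`** (composite): the rev-3 crux is the weakest of the three leaves.
[cite: Tao2016AveragedNS, §4 (4.13)] -/
theorem forwardTailCeilingKP_of_orthantTailCeiling (h : OrthantTailCeiling) : ForwardTailCeilingKP :=
  forwardTailCeilingKP_of_forwardTailCeiling (forwardTailCeiling_of_orthantTailCeiling h)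

/-- Contrapositive: a refutation of the KP crux refutes `ForwardTailCeiling`. [cite: Tao2016AveragedNS, §4 (4.13)] -/
theorem not_forwardTailCeiling_of_not_forwardTailCeilingKP (h : ¬ ForwardTailCeilingKP) : ¬ ForwardTailCeiling :=
  fun hc => h (forwardTailCeilingKP_of_forwardTailCeiling hc)

/-- Contrapositive: a refutation of `ForwardTailCeiling` refutes `OrthantTailCeiling`. [cite: Tao2016AveragedNS, §4 (4.13)] -/
theorem not_orthantTailCeiling_of_not_forwardTailCeiling (h : ¬ ForwardTailCeiling) : ¬ OrthantTailCeiling :=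
  fun hc => h (forwardTailCeiling_of_orthantTailCeiling hc)

end Summit.NavierStokesRegularity.NavierStokesRegularity.Theorems

end
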